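import Literature.AlgebraicGeometry.Motives.HodgeStructureEndAlgSemisimple
import Literature.AlgebraicGeometry.Motives.MumfordTateInvariantsDualForm
import Literature.AlgebraicGeometry.Motives.HodgeStructureQuotient
import Literature.RingTheory.CentralSimple.PositiveInvolutionModuleForms
import Literature.RingTheory.CentralSimple.PositiveInvolutionSubfield
import HarnessLib

/-!
# `(End_{HS}(H), †)` is an Albert pair: a positive anti-involution; the centre is totally real or CM

Family `hodge`, layer `Literature/AlgebraicGeometry/Motives` (lane `lit-hodgefound`, Layer B,
B2-20 / B2-39 / B66 «`HS^pol_ℚ` is a semisimple Tannakian subcategory», TREE side); sequel of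
`Motives/HodgeStructureEndAlgSemisimple` (the adjoint `a ↦ a†` of a polarization `ψ`,
`Tr_V(a† a) > 0`, `End_{HS}(H)` semisimple). THEOREMS plus plumbing `def`s with bodies (`†` as a
`ℚ`-linear map of `End_{HS}(H)`, the trace form `(x, y) ↦ Tr_V(x† y)`); no notion is introduced,
nothing unproved is asserted (0 named facts). It JOINS the Hodge-structure side to the tree's
Albert vocabulary `Literature/RingTheory/CentralSimple/AlbertTypes` (`IsAntiInvolution`,
`IsPositiveAntiInvolution`: "positive" = `Tr_{D/ℚ}(L_{x′x}) > 0`), `PositiveInvolutionModuleForms`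
(Milne CM Prop. 1.37: positivity from an invariant positive-definite form) and
`PositiveInvolutionSubfield` (Lange Lemma 2.6.4 / 2.6.6: a `′`-stable subfield, e.g. the centre,
is totally real or CM), all consumed by name.

Sources read verbatim. B. Moonen, *Families of Motives and the Mumford–Tate Conjecture* (2017)
[Moonen2017FamiliesMotives] (held text `paper:doi-10-1007-s00032-017-0273-x`, p. 3 L9), §2.1: "The
choice of a polarization `φ` gives rise to an involution `d ↦ d*` on `D`, and it can be shown that
this is a positive involution. The pair `(D, *)` is therefore of the type classified by Albert; we
refer to [62], Chapter 21, for further details on this classification. Let us only record here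
that the centre of `D` is either a totally real field or a CM field." D. Mumford, *Abelian
Varieties* (1970) [MumfordAV1970], §21 (positive involutions, Albert's classification; the centre
`K` and its fixed field `K₀` totally real). H. Lange, *Abelian Varieties over the Complex Numbers*
(2023) [Lange2023AbelianVarietiesComplex], §2.6.2 Lemma 2.6.4 / Lemma 2.6.6 (the tree's
`PositiveInvolutionSubfield`). D. Huybrechts, *Lectures on K3 Surfaces* (2016) [Huybrechts2016K3],
§3.3.5 and Cor. 3.3.6 (for an irreducible Hodge structure `End_{HS}` is a division algebra — Schur).

## What is proved

For a pure `ℚ`-Hodge structure `H` of weight `n` on a finite-dimensional `V`, `ψ` a polarization,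
`D = End_{HS}(H) = H.endAlg`:

* `Polarization.adjointEndAlg ψ : D →ₗ[ℚ] D` — `†` on `D` (Huybrechts Lemma 3.3.12), and
  **`Polarization.isAntiInvolution_adjointEndAlg`** — `(D, †)` is a pair `(F, ′)` in the sense of the
  tree's `IsAntiInvolution` (`(ab)† = b† a†`, `a†† = a`).
* `Polarization.adjoint_eq_dualMap_conj` (`a† = θ⁻¹ ∘ ᵗa ∘ θ`, `θ = ψ♭`), `Polarization.trace_adjoint`
  (`Tr_V(a†) = Tr_V(a)`); `Polarization.endAlgTraceForm ψ` — the symmetric `ℚ`-bilinear form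
  `(x, y) ↦ Tr_V(x† y)` on `D`, positive definite (`trace_adjoint_mul_self_pos` of the prequel) and
  invariant, `(b x | y) = (x | b† y)`: **`Polarization.hasInvariantPosDefForm_adjointEndAlg`** (Milne
  CM Prop. 1.37 (14) with `V = B = D`).
* **`Polarization.isPositiveAntiInvolution_adjointEndAlg`** — `(D, †)` IS A POSITIVE PAIR in Albert's
  sense, `Tr_{D/ℚ}(L_{a† a}) > 0` for `a ≠ 0` (Moonen: "a positive involution […] of the type
  classified by Albert"), by the tree's
  `IsAntiInvolution.isPositiveAntiInvolution_of_hasInvariantPosDefForm_self`.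
* **`Polarization.isTotallyReal_or_isCMField_of_algHom`** — every number field `K` embedded in `D`
  with `†`-stable image is totally real or CM (the tree's Lange Lemma 2.6.4/2.6.6,
  `IsPositiveAntiInvolution.isTotallyReal_or_isCMField_of_algHom`); `Polarization.adjoint_mem_center`
  (the centre is `†`-stable) and **`Polarization.isTotallyReal_or_isCMField_of_ringEquiv_center`** —
  any number field isomorphic to the centre `Z(D)` is totally real or CM (Moonen: "the centre of `D`
  is either a totally real field or a CM field").
* Schur: `IsIrreducible.bijective_of_mem_endAlg`, `IsIrreducible.isUnit_endAlg` (a non-zero Hodge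
  endomorphism of an irreducible `H` is a unit of `D`, Huybrechts Cor. 3.3.6) and
  **`IsIrreducible.isField_center_endAlg`** — for irreducible `H` the centre `Z(D)` IS a field (so the
  previous item applies to `K = Z(D)`), of finite dimension over `ℚ` (`finite_center_endAlg`).
-/

noncomputable section

open scoped TensorProduct

namespace Literature.AlgebraicGeometry.Motives

namespace HodgeStructure

open NumberField
open Literature.RingTheory.CentralSimple (IsAntiInvolution IsPositiveAntiInvolution
  HasInvariantPosDefForm exists_linearMap_of_forall_apply_mem_range)

universe u

variable {V : Type u} [AddCommGroup V] [Module ℚ V] {n : ℤ} {H : HodgeStructure V n}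

/-- `(-1)ⁿ · (-1)ⁿ = 1` in `ℚ`. Private plumbing. [folklore] -/
private theorem negOnePow_cast_mul_self_aux (n : ℤ) :
    (((n.negOnePow : ℤˣ) : ℤ) : ℚ) * (((n.negOnePow : ℤˣ) : ℤ) : ℚ) = 1 := by
  rw [← Int.cast_mul, ← Units.val_mul, Int.units_mul_self, Units.val_one, Int.cast_one]

/-! ### `†` on `End_{HS}(H)` as an anti-involution -/

section Adjoint

variable [Module.Finite ℚ V]

/-- **The adjoint involution of `D = End_{HS}(H)`** as a `ℚ`-linear self-map of the subalgebra
`H.endAlg`: `a ↦ a†` (well defined by Huybrechts Lemma 3.3.12, the prequel's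
`Polarization.adjoint_mem_endAlg`; Moonen §2.1: "an involution `d ↦ d*` on `D`").
[cite: Moonen2017FamiliesMotives, §2.1 (p. 3)] [cite: Huybrechts2016K3, §3.3.5 eq. (3.3) and Lemma 3.3.12] -/
def Polarization.adjointEndAlg (ψ : Polarization H) : H.endAlg →ₗ[ℚ] H.endAlg where
  toFun a := ⟨ψ.adjoint a, ψ.adjoint_mem_endAlg a.2⟩
  map_add' a b := Subtype.ext (ψ.adjoint_add a b)
  map_smul' c a := Subtype.ext (ψ.adjoint_smul c a)

/-- Underlying endomorphism of `a†`. [cite: Huybrechts2016K3, §3.3.5 eq. (3.3)] -/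
@[simp]
theorem Polarization.coe_adjointEndAlg_apply (ψ : Polarization H) (a : H.endAlg) :
    ((ψ.adjointEndAlg a : H.endAlg) : Module.End ℚ V) = ψ.adjoint a :=
  rfl

/-- **`(End_{HS}(H), †)` is a pair `(F, ′)`**: `†` is an anti-involution of the `ℚ`-algebra
`End_{HS}(H)` (`(ab)† = b† a†`, `a†† = a`) in the sense of the tree's `IsAntiInvolution`
(Lange §2.6.1; Mumford §21). [cite: Moonen2017FamiliesMotives, §2.1 (p. 3)] [cite: MumfordAV1970, §21] -/
theorem Polarization.isAntiInvolution_adjointEndAlg (ψ : Polarization H) :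
    IsAntiInvolution H.endAlg ψ.adjointEndAlg where
  map_mul a b := Subtype.ext (ψ.adjoint_mul a b)
  apply_apply a := Subtype.ext (ψ.adjoint_adjoint a)

/-- **`a† = θ⁻¹ ∘ ᵗa ∘ θ`** with `θ = ψ♭ : V ≃ V^∨`, `v ↦ ψ(v, ·)` (the tree's
`Polarization.toDualEquiv`): the adjoint is the transpose transported through the polarization.
[cite: Huybrechts2016K3, §3.3.5 eq. (3.3)] -/
theorem Polarization.adjoint_eq_dualMap_conj (ψ : Polarization H) (a : Module.End ℚ V) :
    ψ.adjoint a = (ψ.toDualEquiv.symm : Module.Dual ℚ V →ₗ[ℚ] V) ∘ₗ a.dualMap ∘ₗ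
      (ψ.toDualEquiv : V →ₗ[ℚ] Module.Dual ℚ V) := by
  refine (ψ.eq_adjoint_of_isAdjointPair fun v w => ?_).symm
  rw [LinearMap.comp_apply, LinearMap.comp_apply, LinearEquiv.coe_coe, LinearEquiv.coe_coe,
    ψ.form_swap (ψ.toDualEquiv.symm _) v, ψ.form_toDualEquiv_symm, LinearMap.dualMap_apply,
    ψ.toDualEquiv_apply, ψ.form_swap (a v) w, ← mul_assoc, negOnePow_cast_mul_self_aux, one_mul]

/-- **`Tr_V(a†) = Tr_V(a)`** (`a†` is conjugate to the transpose `ᵗa`, which has the same trace).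
[cite: Huybrechts2016K3, §3.3.5 eq. (3.3)] -/
theorem Polarization.trace_adjoint (ψ : Polarization H) (a : Module.End ℚ V) :
    LinearMap.trace ℚ V (ψ.adjoint a) = LinearMap.trace ℚ V a := by
  have hconj : ψ.adjoint a = ψ.toDualEquiv.symm.conj a.dualMap := by
    rw [ψ.adjoint_eq_dualMap_conj, LinearEquiv.conj_apply, LinearEquiv.symm_symm, LinearMap.comp_assoc]
  rw [hconj, LinearMap.trace_conj']
  exact LinearMap.trace_transpose' (R := ℚ) a

/-- The centre of `End_{HS}(H)` is `†`-stable (the tree's `IsAntiInvolution.apply_mem_center`: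
`z† x = (x† z)† = (z x†)† = x z†`). [cite: MumfordAV1970, §21]
[cite: Lange2023AbelianVarietiesComplex, §2.6.1 (PDF p0137)] -/
theorem Polarization.adjointEndAlg_mem_center (ψ : Polarization H) {z : H.endAlg}
    (hz : z ∈ Subalgebra.center ℚ H.endAlg) : ψ.adjointEndAlg z ∈ Subalgebra.center ℚ H.endAlg := by
  rw [Subalgebra.mem_center_iff] at hz ⊢
  have h := ψ.isAntiInvolution_adjointEndAlg.apply_mem_center (Subring.mem_center_iff.2 hz)
  exact Subring.mem_center_iff.1 h

end Adjoint

/-! ### The trace form `(x, y) ↦ Tr_V(x† y)` and positivity in Albert's sense -/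

section TraceForm

variable [Module.Finite ℚ V]

/-- **The trace form of the adjoint involution** on `D = End_{HS}(H)`: `(x, y) ↦ Tr_V(x† y)`, a
`ℚ`-bilinear form on `D` (Milne CM Prop. 1.37 (14) with `V = B`; Mumford §21 `Tr(x y*)`).
[cite: Moonen2017FamiliesMotives, §2.1 (p. 3)] [cite: MumfordAV1970, §21] -/
def Polarization.endAlgTraceForm (ψ : Polarization H) : LinearMap.BilinForm ℚ H.endAlg :=
  LinearMap.mk₂ ℚ (fun x y : H.endAlg =>
      LinearMap.trace ℚ V (ψ.adjoint (x : Module.End ℚ V) * (y : Module.End ℚ V)))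
    (fun x₁ x₂ y => by
      rw [Subalgebra.coe_add, ψ.adjoint_add, add_mul, map_add])
    (fun c x y => by
      rw [Subalgebra.coe_smul, ψ.adjoint_smul, smul_mul_assoc, map_smul])
    (fun x y₁ y₂ => by
      rw [Subalgebra.coe_add, mul_add, map_add])
    (fun c x y => by
      rw [Subalgebra.coe_smul, mul_smul_comm, map_smul])

/-- Unfolding of the trace form. [cite: MumfordAV1970, §21] -/
@[simp]
theorem Polarization.endAlgTraceForm_apply (ψ : Polarization H) (x y : H.endAlg) :
    ψ.endAlgTraceForm x y =
      LinearMap.trace ℚ V (ψ.adjoint (x : Module.End ℚ V) * (y : Module.End ℚ V)) :=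
  rfl

/-- The trace form is symmetric: `Tr_V(y† x) = Tr_V((x† y)†) = Tr_V(x† y)`. [cite: MumfordAV1970, §21] -/
theorem Polarization.endAlgTraceForm_comm (ψ : Polarization H) (x y : H.endAlg) :
    ψ.endAlgTraceForm x y = ψ.endAlgTraceForm y x := by
  rw [ψ.endAlgTraceForm_apply, ψ.endAlgTraceForm_apply, ← ψ.trace_adjoint (ψ.adjoint _ * _),
    ψ.adjoint_mul, ψ.adjoint_adjoint]

/-- The trace form is positive definite: `Tr_V(x† x) > 0` for `x ≠ 0` (the prequel's
`Polarization.trace_adjoint_mul_self_pos`, second Hodge–Riemann relation).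
[cite: Moonen2017FamiliesMotives, §2.1 (p. 3)] [cite: MumfordAV1970, §21] -/
theorem Polarization.endAlgTraceForm_self_pos (ψ : Polarization H) {x : H.endAlg} (hx : x ≠ 0) :
    0 < ψ.endAlgTraceForm x x :=
  ψ.trace_adjoint_mul_self_pos x.2 fun h => hx (Subtype.ext h)

/-- The trace form is invariant: `(b x | y) = (x | b† y)` (`(b x)† y = x† b† y`).
[cite: MilneCM2006, Ch. I §1 Prop. 1.37 (14) (p. 20)] [cite: MumfordAV1970, §21] -/
theorem Polarization.endAlgTraceForm_mul_left (ψ : Polarization H) (b x y : H.endAlg) :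
    ψ.endAlgTraceForm (b * x) y = ψ.endAlgTraceForm x (ψ.adjointEndAlg b * y) := by
  rw [ψ.endAlgTraceForm_apply, ψ.endAlgTraceForm_apply, Subalgebra.coe_mul, Subalgebra.coe_mul,
    ψ.coe_adjointEndAlg_apply, ψ.adjoint_mul, mul_assoc]

/-- **Milne's condition (14) for `V = B = D`**: `D = End_{HS}(H)` carries a positive definite symmetric
`ℚ`-bilinear form with `(b u | v) = (u | b† v)`, namely the trace form `Tr_V(u† v)` — the tree's
`HasInvariantPosDefForm`. [cite: MilneCM2006, Ch. I §1 Prop. 1.37 (14) (p. 20)]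
[cite: Moonen2017FamiliesMotives, §2.1 (p. 3)] -/
theorem Polarization.hasInvariantPosDefForm_adjointEndAlg (ψ : Polarization H) :
    HasInvariantPosDefForm ψ.adjointEndAlg H.endAlg :=
  ⟨ψ.endAlgTraceForm, ψ.endAlgTraceForm_comm, fun _ hx => ψ.endAlgTraceForm_self_pos hx,
    fun b u v => by rw [smul_eq_mul, smul_eq_mul, ψ.endAlgTraceForm_mul_left]⟩

/-- **`(End_{HS}(H), †)` is a positive pair in Albert's sense** (Moonen §2.1: "it can be shown that
this is a positive involution. The pair `(D, *)` is therefore of the type classified by Albert";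
Mumford §21): `Tr_{D/ℚ}(L_{a† a}) > 0` for `0 ≠ a ∈ D` — the tree's `IsPositiveAntiInvolution`, obtained
from the invariant positive-definite trace form by Milne CM Prop. 1.37 ((b) ⟹ (c) with `W = B`, the
tree's `IsAntiInvolution.isPositiveAntiInvolution_of_hasInvariantPosDefForm_self`).
[cite: Moonen2017FamiliesMotives, §2.1 (p. 3)] [cite: MumfordAV1970, §21]
[cite: MilneCM2006, Ch. I §1 Prop. 1.37 (p. 20)] -/
theorem Polarization.isPositiveAntiInvolution_adjointEndAlg (ψ : Polarization H) :
    IsPositiveAntiInvolution H.endAlg ψ.adjointEndAlg := by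
  haveI : Module.Finite ℚ H.endAlg := finite_endAlg H
  exact ψ.isAntiInvolution_adjointEndAlg.isPositiveAntiInvolution_of_hasInvariantPosDefForm_self
    ψ.hasInvariantPosDefForm_adjointEndAlg

end TraceForm

/-! ### `†`-stable subfields and the centre are totally real or CM -/

section Center

variable [Module.Finite ℚ V]

/-- **A `†`-stable number field inside `End_{HS}(H)` is totally real or CM** (Lange Lemma 2.6.4 /
2.6.6 for the positive pair `(End_{HS}(H), †)`, the tree's
`IsPositiveAntiInvolution.isTotallyReal_or_isCMField_of_algHom`; Shimura §5.1 Lemma 2): for any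
number field `K` and `ℚ`-algebra map `f : K → End_{HS}(H)` with `(f K)† ⊆ f K`. (`V ≠ 0`, so that
`End_{HS}(H) ≠ 0`.) [cite: Lange2023AbelianVarietiesComplex, §2.6.2 Lemma 2.6.4 (PDF p0141) and Lemma 2.6.6 (p0144)]
[cite: Moonen2017FamiliesMotives, §2.1 (p. 3)] -/
theorem Polarization.isTotallyReal_or_isCMField_of_algHom [Nontrivial V] (ψ : Polarization H)
    {K : Type*} [Field K] [NumberField K] (f : K →ₐ[ℚ] H.endAlg)
    (hst : ∀ x : K, ψ.adjointEndAlg (f x) ∈ f.range) : IsTotallyReal K ∨ IsCMField K := by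
  haveI : Module.Finite ℚ H.endAlg := finite_endAlg H
  obtain ⟨τ, hτ⟩ := exists_linearMap_of_forall_apply_mem_range f hst
  exact ψ.isPositiveAntiInvolution_adjointEndAlg.isTotallyReal_or_isCMField_of_algHom f hτ

/-- **The centre of `End_{HS}(H)` is totally real or CM** (Moonen §2.1: "the centre of `D` is either
a totally real field or a CM field"; Mumford §21): every number field `K` isomorphic (as a ring) to
the centre `Z(End_{HS}(H))` is totally real or a CM field — the centre is `†`-stable
(`adjointEndAlg_mem_center`). When `H` is irreducible the centre is indeed a field
(`IsIrreducible.isField_center_endAlg`) of finite dimension over `ℚ` (`finite_center_endAlg`).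
[cite: Moonen2017FamiliesMotives, §2.1 (p. 3)] [cite: MumfordAV1970, §21]
[cite: Lange2023AbelianVarietiesComplex, §2.6.2 Lemma 2.6.4 (PDF p0141) and Lemma 2.6.6 (p0144)] -/
theorem Polarization.isTotallyReal_or_isCMField_of_ringEquiv_center [Nontrivial V]
    (ψ : Polarization H) {K : Type*} [Field K] [NumberField K]
    (e : K ≃+* Subalgebra.center ℚ H.endAlg) : IsTotallyReal K ∨ IsCMField K := by
  set f : K →ₐ[ℚ] H.endAlg :=
    (((Subalgebra.center ℚ H.endAlg).val : Subalgebra.center ℚ H.endAlg →ₐ[ℚ] H.endAlg).toRingHom.comp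
      e.toRingHom).toRatAlgHom with hf
  have hfx : ∀ x : K, f x = ((e x : Subalgebra.center ℚ H.endAlg) : H.endAlg) := fun x => rfl
  refine ψ.isTotallyReal_or_isCMField_of_algHom f fun x => ?_
  have hc : ψ.adjointEndAlg (f x) ∈ Subalgebra.center ℚ H.endAlg := by
    rw [hfx]
    exact ψ.adjointEndAlg_mem_center (e x).2
  refine (AlgHom.mem_range f).2 ⟨e.symm ⟨ψ.adjointEndAlg (f x), hc⟩, ?_⟩
  rw [hfx, RingEquiv.apply_symm_apply]

/-- The centre of `End_{HS}(H)` is finite-dimensional over `ℚ` (so, when a field, a number field).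
[cite: Moonen2017FamiliesMotives, §2.1 (p. 3)] -/
theorem finite_center_endAlg (H : HodgeStructure V n) :
    Module.Finite ℚ (Subalgebra.center ℚ H.endAlg) := by
  haveI : Module.Finite ℚ H.endAlg := finite_endAlg H
  exact Module.Finite.of_injective (Subalgebra.center ℚ H.endAlg).val.toLinearMap
    Subtype.val_injective

end Center

/-! ### Schur: for irreducible `H`, `End_{HS}(H)` is a division algebra and its centre a field -/

section Schur

variable [Module.Finite ℚ V]

/-- **Schur's lemma for Hodge structures**: a non-zero Hodge endomorphism of an IRREDUCIBLE Hodge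
structure is bijective — its kernel is a sub-Hodge structure (the tree's `Hom.ker`, Voisin Lemma
7.25), hence `0`, and an injective endomorphism of a finite-dimensional space is bijective
(Huybrechts Cor. 3.3.6: "`End_{Hdg}(T)` is a division algebra"). [cite: Huybrechts2016K3, Ch. 3 Cor. 3.3.6 (p. 65)]
[cite: VoisinHodgeI2002, §7.3.1 Lemma 7.25] -/
theorem IsIrreducible.bijective_of_mem_endAlg (hirr : H.IsIrreducible) {a : Module.End ℚ V}
    (ha : a ∈ H.endAlg) (ha0 : a ≠ 0) : Function.Bijective a := by
  have hker : LinearMap.ker a = ⊥ := by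
    rcases hirr.eq_bot_or_eq_top (endAlg.toHom ⟨a, ha⟩).ker with h | h
    · simpa [Hom.ker_toSubmodule] using h
    · exfalso
      apply ha0
      refine LinearMap.ext fun v => ?_
      have hv : v ∈ (endAlg.toHom ⟨a, ha⟩).ker.toSubmodule := h ▸ Submodule.mem_top
      simpa [Hom.ker_toSubmodule] using hv
  have hinj : Function.Injective a := LinearMap.ker_eq_bot.1 hker
  exact ⟨hinj, LinearMap.surjective_of_injective hinj⟩

/-- **`End_{HS}(H)` of an irreducible `H` is a division algebra**: every non-zero element of `H.endAlg`
is a unit, the inverse of a bijective morphism being a morphism (the tree's `Hom.inverse`, Voisin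
Lemma 7.23). [cite: Huybrechts2016K3, Ch. 3 Cor. 3.3.6 (p. 65)] [cite: VoisinHodgeI2002, §7.3.1 Lemma 7.23] -/
theorem IsIrreducible.isUnit_endAlg (hirr : H.IsIrreducible) (a : H.endAlg) (ha0 : a ≠ 0) : IsUnit a := by
  have hbij : Function.Bijective (endAlg.toHom a).toLinearMap :=
    hirr.bijective_of_mem_endAlg a.2 fun h => ha0 (Subtype.ext h)
  set g : Hom H H := (endAlg.toHom a).inverse hbij with hg
  refine ⟨⟨a, ⟨g.toLinearMap, g.toLinearMap_mem_endAlg⟩, ?_, ?_⟩, rfl⟩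
  · exact Subtype.ext (LinearMap.ext fun v => (endAlg.toHom a).apply_inverse_apply hbij v)
  · exact Subtype.ext (LinearMap.ext fun v => (endAlg.toHom a).inverse_apply_apply hbij v)

/-- **For irreducible `H` the centre of `End_{HS}(H)` is a field** (the centre of a division algebra;
Moonen §2.1: "the centre of `D` is […] a field"; Lange §2.6.1: "Let `K` denote the centre of the skew
field `F`"). [cite: Moonen2017FamiliesMotives, §2.1 (p. 3)]
[cite: Lange2023AbelianVarietiesComplex, §2.6.1 (PDF p0137)] [cite: Huybrechts2016K3, Ch. 3 Cor. 3.3.6 (p. 65)] -/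
theorem IsIrreducible.isField_center_endAlg (hirr : H.IsIrreducible) :
    IsField (Subalgebra.center ℚ H.endAlg) := by
  haveI : Nontrivial V := hirr.1
  refine ⟨⟨0, 1, fun h => ?_⟩, mul_comm, fun {z} hz => ?_⟩
  · have h' := congrArg (fun w : Subalgebra.center ℚ H.endAlg => ((w : H.endAlg) : Module.End ℚ V)) h
    simp only [ZeroMemClass.coe_zero, OneMemClass.coe_one] at h'
    exact zero_ne_one h'
  have hz0 : (z : H.endAlg) ≠ 0 := fun h => hz (Subtype.ext h)
  obtain ⟨u, hu⟩ := hirr.isUnit_endAlg z hz0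
  have hc : ((u⁻¹ : (H.endAlg)ˣ) : H.endAlg) ∈ Subalgebra.center ℚ H.endAlg := by
    rw [Subalgebra.mem_center_iff]
    have hzc : ((u : (H.endAlg)ˣ) : H.endAlg) ∈ Set.center (H.endAlg : Type u) := by
      rw [hu, Semigroup.mem_center_iff]
      exact Subalgebra.mem_center_iff.1 z.2
    exact Semigroup.mem_center_iff.1 (Set.units_inv_mem_center hzc)
  refine ⟨⟨_, hc⟩, Subtype.ext ?_⟩
  change (z : H.endAlg) * ((u⁻¹ : (H.endAlg)ˣ) : H.endAlg) = 1
  rw [← hu, Units.mul_inv]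

end Schur

end HodgeStructure

end Literature.AlgebraicGeometry.Motives

end
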